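import Summits.Ventures.LatticeQCDFlow.Scaling.SwapLadderIndexTauIntOptimumShape

/-!
HONEST FRAMING: exact (Metropolis-corrected) sampling algorithms for lattice gauge theory; figures
of merit are autocorrelation/cost numbers at stated couplings and volumes; no continuum-physics
claim.

# SwapLadderIndexTauIntClosedSimplex — THE INDEX COST ON THE CLOSED GAP SIMPLEX: A MINIMISER EXISTS (COMPACTNESS),
# A POSITIVE ONE IS INDEX-OPTIMAL, AND AT THE BOUNDARY THE ONE-SIDED FERMAT CONDITION `w_i²·G′(v_i) ≤ w_j²·G′(v_j)`
# HOLDS FOR EVERY `j` WHENEVER `v_i > 0` (row 22 `su3-ptbc`, GEN-8, ours; part 2 of 3 of the collapse-threshold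
# packet — `SwapLadderIndexTauIntCritGap`, `SwapLadderIndexTauIntThreshold`)

Venture `LatticeQCDFlow` (cell pub-lqcd), topic `Scaling`; FANOUT row 22 (`su3-ptbc`).  NEW WORK of the cell over
GEN-7's `SwapLadderIndexTauIntOptimumShape` (`gapIndexCost K ℓ = Σ_j w_j²·G(ℓ_j)`, the positive simplex `gapSimplex`,
two-gap shifts `gapShift` with `sum_gapShift`, `gapShift_left/right/of_ne`, `hasDerivAt_gapIndexCost_gapShift`) and
GEN-6's `SwapLadderRoundTripOptimum` (`continuous_gaussInvAcc`).  Mathlib otherwise (`IsCompact.exists_isMinOn`,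
`HasDerivAt.tendsto_slope_zero_right`, `Ioo_mem_nhdsGT`).  Nothing is cited as a fact; no `native_decide`.

THE POINT (model statements).  `SwapLadderIndexTauIntOptimumShape` works on the OPEN simplex of positive gap vectors
and warns that a minimiser may fail to exist there.  On the CLOSED simplex (zero gaps allowed — a zero gap is two
replicas at the same coupling) the picture is complete:

* §1 `closedGapSimplex K Λ ⊆ (Fin K → ℝ)` is compact (`isCompact_closedGapSimplex`), the cost `finIndexCost` is
  continuous, so for `K ≥ 1`, `Λ ≥ 0` **a minimiser EXISTS** (`exists_isMinOn_closedGapSimplex`); the dictionary with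
  the `ℕ`-indexed gap vectors of the parent (`extendGaps`, `finIndexCost_eq_gapIndexCost`, `finIndexCost_restrict`,
  `sum_range_extendGaps`); and **a closed-simplex minimiser with all gaps positive is index-optimal among the positive
  gap vectors** (`isMinOn_gapSimplex_of_closed`) — so the shape theorems of the parent and the uniqueness of the staged
  `SwapLadderIndexTauIntOptimumUnique` apply to it.
* §2 **ONE-SIDED FERMAT AT THE BOUNDARY** (`weight_sq_mul_deriv_le_of_isMinOn_closed`): at a closed-simplex
  minimiser `v`, for every gap `i` with `v_i > 0` and EVERY `j`: `w_i²·G′(v_i) ≤ w_j²·G′(v_j)` — shifting a little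
  stiffness out of the positive gap `i` into `j` is feasible (`gapShift_restrict_mem`) and changes the cost at rate
  `w_j²·G′(v_j) − w_i²·G′(v_i)`, which therefore cannot be negative (slope limit from the right).  Between two positive
  gaps this is the parent's two-sided stationarity; against a ZERO gap `j` it reads `w_i²·G′(v_i) ≤ w_j²·G′(0)`, the
  inequality the sequel turns into the collapse threshold.

NOT CLAIMED: positivity of the closed-simplex minimiser (false for small `Λ`; the exact criterion `Λ > Λ_c(K)` is the
sequel `SwapLadderIndexTauIntThreshold`), uniqueness on the closed simplex, anything about PTBC itself or a run.
-/

noncomputable section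

open Finset Real Filter Topology

namespace Summit.Ventures.LatticeQCDFlow.Scaling

/-! ## §1 The closed simplex: compactness, existence of a minimiser, the bridge to the positive simplex -/

section Closed

variable {K : ℕ} {Λ : ℝ}

/-- The CLOSED simplex of nonnegative gap vectors with `K` gaps and total stiffness `Λ`, in `Fin K → ℝ`. [ours] -/
def closedGapSimplex (K : ℕ) (Λ : ℝ) : Set (Fin K → ℝ) := {v | (∀ i, 0 ≤ v i) ∧ ∑ i, v i = Λ}

/-- The index cost on `Fin K → ℝ`: `Σ_i w_i²·G(v_i)`. [ours] -/
def finIndexCost (K : ℕ) (v : Fin K → ℝ) : ℝ := ∑ i : Fin K, passageWeight K (i : ℕ) ^ 2 * gaussInvAcc (v i)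

/-- The closed simplex is compact (a closed subset of the box `[0, Λ]^K`). [ours] -/
theorem isCompact_closedGapSimplex (K : ℕ) (Λ : ℝ) : IsCompact (closedGapSimplex K Λ) := by
  have hbox : closedGapSimplex K Λ ⊆ Set.Icc (fun _ => (0 : ℝ)) (fun _ => Λ) := by
    intro v hv
    refine ⟨fun i => hv.1 i, fun i => ?_⟩
    have := single_le_sum (f := v) (fun j _ => hv.1 j) (mem_univ i)
    simpa [hv.2] using this
  have hclosed : IsClosed (closedGapSimplex K Λ) := by
    have h1 : IsClosed {v : Fin K → ℝ | ∀ i, 0 ≤ v i} := by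
      have : {v : Fin K → ℝ | ∀ i, 0 ≤ v i} = ⋂ i, {v | 0 ≤ v i} := by ext v; simp
      rw [this]
      exact isClosed_iInter fun i => isClosed_le continuous_const (continuous_apply i)
    have h2 : IsClosed {v : Fin K → ℝ | ∑ i, v i = Λ} :=
      isClosed_eq (continuous_finsetSum _ fun i _ => continuous_apply i) continuous_const
    simpa [closedGapSimplex, Set.setOf_and] using h1.inter h2
  exact isCompact_Icc.of_isClosed_subset hclosed hbox

/-- The cost is continuous. [ours] -/
theorem continuous_finIndexCost (K : ℕ) : Continuous (finIndexCost K) := by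
  unfold finIndexCost
  exact continuous_finsetSum _ fun i _ => continuous_const.mul (continuous_gaussInvAcc.comp (continuous_apply i))

/-- **EXISTENCE ON THE CLOSED SIMPLEX**: for `K ≥ 1`, `Λ ≥ 0` some NONNEGATIVE gap vector minimises the index cost
(compactness + continuity).  Whether it is positive is the business of §4. [ours] -/
theorem exists_isMinOn_closedGapSimplex (hK : 0 < K) (hΛ : 0 ≤ Λ) :
    ∃ v ∈ closedGapSimplex K Λ, IsMinOn (finIndexCost K) (closedGapSimplex K Λ) v := by
  have hne : (closedGapSimplex K Λ).Nonempty := by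
    refine ⟨fun _ => Λ / K, fun i => by positivity, ?_⟩
    have hK0 : (K : ℝ) ≠ 0 := by exact_mod_cast hK.ne'
    rw [sum_const, card_univ, Fintype.card_fin, nsmul_eq_mul]
    field_simp
  exact (isCompact_closedGapSimplex K Λ).exists_isMinOn hne (continuous_finIndexCost K).continuousOn

/-- Extension of `v : Fin K → ℝ` to a gap vector on `ℕ` (zero beyond `K`). [ours] -/
def extendGaps (K : ℕ) (v : Fin K → ℝ) (j : ℕ) : ℝ := if h : j < K then v ⟨j, h⟩ else 0

/-- `extendGaps` agrees with `v` below `K`. [ours] -/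
theorem extendGaps_apply (v : Fin K → ℝ) (i : Fin K) : extendGaps K v i = v i := by
  simp [extendGaps, i.isLt]

/-- `finIndexCost K v = gapIndexCost K (extendGaps K v)`. [ours] -/
theorem finIndexCost_eq_gapIndexCost (v : Fin K → ℝ) : finIndexCost K v = gapIndexCost K (extendGaps K v) := by
  unfold finIndexCost gapIndexCost
  rw [← Fin.sum_univ_eq_sum_range (fun j => passageWeight K j ^ 2 * gaussInvAcc (extendGaps K v j)) K]
  exact sum_congr rfl fun i _ => by rw [extendGaps_apply]

/-- Restricting a gap vector on `ℕ` to `Fin K` has the same cost. [ours] -/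
theorem finIndexCost_restrict (ℓ : ℕ → ℝ) : finIndexCost K (fun i : Fin K => ℓ i) = gapIndexCost K ℓ := by
  unfold finIndexCost gapIndexCost
  exact Fin.sum_univ_eq_sum_range (fun j => passageWeight K j ^ 2 * gaussInvAcc (ℓ j)) K

/-- The total stiffness of `extendGaps K v` is `Σ_i v_i`. [ours] -/
theorem sum_range_extendGaps (v : Fin K → ℝ) : ∑ k ∈ range K, extendGaps K v k = ∑ i, v i := by
  rw [← Fin.sum_univ_eq_sum_range (fun j => extendGaps K v j) K]
  exact sum_congr rfl fun i _ => extendGaps_apply v i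

/-- **BRIDGE: a closed-simplex minimiser with all gaps POSITIVE is index-optimal among the positive gap vectors**
(so `SwapLadderIndexTauIntOptimumShape` applies to it). [ours] -/
theorem isMinOn_gapSimplex_of_closed {v : Fin K → ℝ} (hv : v ∈ closedGapSimplex K Λ)
    (hmin : IsMinOn (finIndexCost K) (closedGapSimplex K Λ) v) (hpos : ∀ i, 0 < v i) :
    extendGaps K v ∈ gapSimplex K Λ ∧ IsMinOn (gapIndexCost K) (gapSimplex K Λ) (extendGaps K v) := by
  have hsum : ∑ k ∈ range K, extendGaps K v k = Λ := by rw [sum_range_extendGaps, hv.2]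
  refine ⟨⟨fun k hk => by simpa [extendGaps, hk] using hpos ⟨k, hk⟩, hsum⟩, isMinOn_iff.mpr fun ℓ' hℓ' => ?_⟩
  have hmem : (fun i : Fin K => ℓ' i) ∈ closedGapSimplex K Λ := by
    refine ⟨fun i => (hℓ'.1 i i.isLt).le, ?_⟩
    rw [Fin.sum_univ_eq_sum_range (fun j => ℓ' j) K]
    exact hℓ'.2
  have h := isMinOn_iff.mp hmin _ hmem
  rwa [finIndexCost_eq_gapIndexCost, finIndexCost_restrict] at h

/-! ## §2 The one-sided Fermat condition at the boundary -/

variable {v : Fin K → ℝ} {i j : Fin K}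

/-- Shifting `δ ∈ [0, v_i]` of stiffness from gap `i` to gap `j` keeps a closed-simplex vector feasible. [ours] -/
theorem gapShift_restrict_mem (hv : v ∈ closedGapSimplex K Λ) (hij : i ≠ j) {δ : ℝ} (hδ0 : 0 ≤ δ)
    (hδ : δ ≤ v i) : (fun k : Fin K => gapShift (extendGaps K v) j i δ k) ∈ closedGapSimplex K Λ := by
  have hji : (j : ℕ) ≠ (i : ℕ) := fun h => hij (Fin.ext h).symm
  refine ⟨fun k => ?_, ?_⟩
  · by_cases hkj : k = j
    · subst hkj
      show 0 ≤ gapShift (extendGaps K v) k i δ k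
      rw [gapShift_left hji, extendGaps_apply]
      linarith [hv.1 k]
    by_cases hki : k = i
    · subst hki
      show 0 ≤ gapShift (extendGaps K v) j k δ k
      rw [gapShift_right hji, extendGaps_apply]
      linarith
    · show 0 ≤ gapShift (extendGaps K v) j i δ k
      rw [gapShift_of_ne (fun h => hkj (Fin.ext h)) (fun h => hki (Fin.ext h)), extendGaps_apply]
      exact hv.1 k
  · rw [Fin.sum_univ_eq_sum_range (fun k => gapShift (extendGaps K v) j i δ k) K, sum_gapShift j.isLt i.isLt,
      sum_range_extendGaps, hv.2]

/-- **ONE-SIDED FERMAT AT THE BOUNDARY: at a closed-simplex minimiser, `w_i²·G′(v_i) ≤ w_j²·G′(v_j)` for every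
`j` whenever `v_i > 0`** — otherwise shifting a little stiffness from gap `i` to gap `j` (feasible, since `v_i > 0`)
would lower the cost at rate `w_j²·G′(v_j) − w_i²·G′(v_i) < 0`.  For two positive gaps this is the two-sided
stationarity of `SwapLadderIndexTauIntOptimumShape`. [ours] -/
theorem weight_sq_mul_deriv_le_of_isMinOn_closed (hv : v ∈ closedGapSimplex K Λ)
    (hmin : IsMinOn (finIndexCost K) (closedGapSimplex K Λ) v) (hi : 0 < v i) (j : Fin K) :
    passageWeight K i ^ 2 * deriv gaussInvAcc (v i) ≤ passageWeight K j ^ 2 * deriv gaussInvAcc (v j) := by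
  by_cases hij : i = j
  · subst hij; exact le_rfl
  by_contra hcon
  rw [not_le] at hcon
  set ℓ := extendGaps K v with hℓ
  have hji : (j : ℕ) ≠ (i : ℕ) := fun h => hij (Fin.ext h).symm
  have hd := hasDerivAt_gapIndexCost_gapShift (ℓ := ℓ) hji j.isLt i.isLt
  have hneg : passageWeight K j ^ 2 * deriv gaussInvAcc (ℓ j) - passageWeight K i ^ 2 * deriv gaussInvAcc (ℓ i)
      < 0 := by
    simp only [hℓ, extendGaps_apply]; linarith
  have hev1 := (hd.tendsto_slope_zero_right).eventually (gt_mem_nhds hneg)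
  have hev2 : ∀ᶠ δ in 𝓝[>] (0 : ℝ), δ ∈ Set.Ioo 0 (v i) := Ioo_mem_nhdsGT hi
  obtain ⟨δ, h1, h2⟩ := (hev1.and hev2).exists
  simp only [zero_add, gapShift_zero, smul_eq_mul] at h1
  have hδ : 0 < δ := h2.1
  have hlt : gapIndexCost K (gapShift ℓ j i δ) < gapIndexCost K ℓ := by
    have hinv : 0 < δ⁻¹ := inv_pos.2 hδ
    by_contra hge
    rw [not_lt] at hge
    have := mul_nonneg hinv.le (sub_nonneg.2 hge)
    linarith
  have hmem := gapShift_restrict_mem hv hij hδ.le h2.2.le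
  have hcost := isMinOn_iff.1 hmin _ hmem
  rw [finIndexCost_restrict, finIndexCost_eq_gapIndexCost, ← hℓ] at hcost
  linarith

end Closed

end Summit.Ventures.LatticeQCDFlow.Scaling

end
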